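import Literature.Dynamics.Ergodic.ExactEndomorphisms
import Literature.Dynamics.Ergodic.ToralTranslations
import Mathlib.LinearAlgebra.FreeModule.PID
import Mathlib.LinearAlgebra.Matrix.Charpoly.Coeff
import Mathlib.LinearAlgebra.Charpoly.ToMatrix
import Mathlib.RingTheory.Localization.Module
import HarnessLib

/-!
# Exactness of the endomorphisms of a torus: Rohlin's criterion `⋂ₙ ℤ^d Aⁿ = 0` and Krzyżewski's theorem
# «`T_A` is exact iff no unimodular polynomial divides `χ_A`»

Layer `Literature/Dynamics/Ergodic`, namespace `Literature.Dynamics.Ergodic` (sub-namespace `ToralEndomorphism`).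
General dynamics file (imports: the tree's `ExactEndomorphisms` = Walters' Definition 4.14, `ToralEndomorphisms` /
`ToralTranslations` = characters and Fourier coefficients on Mathlib's `UnitAddTorus d`, and Mathlib), written for
lane `lit-hodgefound` (prover seat `lit-hodgefound-p31`), whose lane file
`Literature/AlgebraicGeometry/HodgeTheory/AbelianVarietyExactEndomorphisms.lean` reads it on complex tori and on
the complex points of abelian varieties.

## The printed statements

* P. Walters, *An Introduction to Ergodic Theory* (GTM 79, 1982), §4.9 Definition 4.14 (held chunk p0126): `T` is
  an exact endomorphism iff `⋂ₙ T⁻ⁿ𝓑 ≗ 𝓝` (the tree's `IsExactEndomorphism`).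
* J. Cuntz, A. Vershik, *C\*-algebras associated with endomorphisms and polymorphisms of compact abelian groups*,
  Comm. Math. Phys. 321 (2013), §2 (held arXiv:1202.5960 chunk p0005), after V. A. Rohlin (1961): for the dual
  endomorphism `φ = α̂` of the dual group `G = Ĥ` of a compact abelian group `H`, «`⋂_{n ∈ ℕ} φⁿ G = {0}` which, by
  duality, means that `⋃_{n ∈ ℕ} Ker αⁿ` is dense in `H` […] For an algebraic endomorphism of the compact group `H`
  this condition [exactness] means exactly that the subgroup `⋃_{n∈ℕ} Ker αⁿ` is dense in `H`.»  For `H = 𝕋^d`,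
  `G = ℤ^d` and `φ(k) = A_t k` (row vectors: `k ↦ k A`), so the condition reads **`⋂ₙ ℤ^d Aⁿ = {0}`**.
* K. Krzyżewski, *On exact toral endomorphisms*, Monatsh. Math. 116 (1993) 39–47 (abstract: «A necessary and
  sufficient condition for the exactness of a toral endomorphism is given in terms of the characteristic polynomial
  of the matrix which induces it»), as restated in K. K. S. Andersen, K. Thomsen, *The C\*-algebra of an affine map
  on the 3-torus*, Doc. Math. 17 (2012), **Theorem 4.1** (held arXiv:1204.0224 chunk p0010): «a non-constant
  polynomial `a_k x^k + ⋯ + a_0` is called unimodular when `a_i ∈ ℤ` for all `i`, `a_k = 1`, and `a_0 ∈ {−1, 1}`.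
  (Krzyzewski, [Kr]) Let `A ∈ M_n(ℤ)` be non-singular, i.e. `Det A ≠ 0`, and let `f_A(x) = Det(x1 − A)` be the
  characteristic polynomial of `A`. The group endomorphism `φ_A` of `𝕋ⁿ` is strongly transitive [⟺ exact for a
  group endomorphism with finite kernel, Prop. 2.9 ibid.] if and only if no unimodular polynomial divides `f_A`.»

## What is formalised (theorems only; no definition, no named fact)

The torus is Mathlib's `UnitAddTorus d = d → ℝ/ℤ` with its Haar probability measure `volume`; `T` is any map with
`T x = (Σ_j A_{ij} x_j)_i` (hypothesis `hT`, as in `ToralEndomorphisms.lean`); the dual action is `k ↦ k ᵥ* A`.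
* §1 `exists_apply_eq_zero_and_mFourier_ne_one` — a character `χ_m` with `m ∉ ℤ^d A` is non-trivial on `ker T_A`
  (`det A ≠ 0`; the points `A_ℝ⁻¹ e_j mod ℤ^d`);
* §2 **`mFourierCoeff_comp_eq_zero`** — `ĉ_m(f ∘ T_A) = 0` for `m ∉ ℤ^d A` and EVERY `f` (translate by a point of
  `ker T_A`: `ToralTranslation.mFourierCoeff_comp_add_right`);
* §3 `isTailTrivial_of_forall_exists` — if every `m ≠ 0` leaves `ℤ^d Aⁿ` for some `n` then `𝓑_∞(T_A) ≗ 𝓝`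
  (a set `T_A⁻ⁿ t` has no coefficients off `ℤ^d Aⁿ`; `ToralTranslation.ae_eq_const_of_forall_mFourierCoeff_eq_zero`);
* §4 `not_isTailTrivial_of_forall_exists` — a character `χ_m`, `0 ≠ m ∈ ⋂ₙ ℤ^d Aⁿ`, is `𝓑_∞`-measurable
  (`χ_m = χ_{k_n} ∘ T_Aⁿ`), and `{Re χ_m < 0}` is an open set of intermediate measure;
* §5 **`isExactEndomorphism_iff_forall_exists`** (Rohlin's criterion on `𝕋^d`): for `det A ≠ 0`, `T_A` is an
  exact endomorphism iff `⋂ₙ ℤ^d Aⁿ = 0`;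
* §6 the algebra of `⋂ₙ ℤ^d Aⁿ`: `exists_ne_zero_forall_exists_of_dvd_charpoly` (a unimodular `g ∣ χ_A` produces
  the `A`-stable lattice `ker_ℤ g(A) ≠ 0` inside `⋂ₙ ℤ^d Aⁿ`) and `exists_unimodular_dvd_charpoly` (conversely
  `⋂ₙ ℤ^d Aⁿ` is a lattice on which `·A` is a `ℤ`-automorphism; its characteristic polynomial is unimodular and
  divides `χ_A` — block-triangular form over `ℚ`);
* §7 **`isExactEndomorphism_iff_forall_not_dvd_charpoly`** (Krzyżewski's theorem) and the corollaries
  `isExactEndomorphism_of_forall_one_lt_norm` (all eigenvalues of modulus `> 1` ⟹ exact),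
  `not_isExactEndomorphism_of_isUnit_det` (automorphisms, `det A = ±1`, are never exact), and
  `ergodic_of_forall_not_dvd_charpoly` (exact ⟹ ergodic, through `IsExactEndomorphism.ergodic`).

## References

* [Krzyzewski1993] K. Krzyżewski, *On exact toral endomorphisms*, Monatsh. Math. 116 (1993) 39–47 (cite-only;
  statement as restated in [AndersenThomsen2012] Thm. 4.1).
* [AndersenThomsen2012] K. K. S. Andersen, K. Thomsen, *The C\*-algebra of an affine map on the 3-torus*, Doc. Math.
  17 (2012) 545–572, §2.5 Proposition 2.9 and §4 Theorem 4.1 (held text arXiv:1204.0224 chunks p0007, p0010).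
* [CuntzVershik2012] J. Cuntz, A. Vershik, Comm. Math. Phys. 321 (2013) 157–179, §2 (held text arXiv:1202.5960
  chunk p0005).
* [Rohlin1964] V. A. Rohlin, *Exact endomorphisms of a Lebesgue space*, Izv. Akad. Nauk SSSR 25 (1961) 499–530;
  AMS Transl. (2) 39 (1964) 1–36 (cite-only).
* [Walters1982] P. Walters, *An Introduction to Ergodic Theory*, GTM 79 (1982), §4.9 Def. 4.14 (held chunk p0126),
  §0.8 (characters of `Kⁿ`, the dual action `[A]_t`).
-/

noncomputable section

open MeasureTheory MeasureTheory.Measure Set Filter Function Finset Matrix Polynomial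
open scoped ENNReal

namespace Literature.Dynamics.Ergodic

namespace ToralEndomorphism

variable {d : Type*} [Fintype d] [DecidableEq d] (A : Matrix d d ℤ)
  {T : UnitAddTorus d → UnitAddTorus d} (hT : ∀ x i, T x i = ∑ j, A i j • x j)

/-! ### §1 Characters that are trivial on `ker T_A` come from `ℤ^d A` -/

omit [DecidableEq d] in
include hT in
/-- `T_A` is additive. [cite: Walters1982, §0.8 (held text chunk p0043)] -/
private theorem map_add_eq' (x y : UnitAddTorus d) : T (x + y) = T x + T y := by
  funext i
  rw [Pi.add_apply, hT, hT, hT, ← sum_add_distrib]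
  exact sum_congr rfl fun j _ ↦ by rw [Pi.add_apply, smul_add]

/-- The real matrix `A_ℝ` of a non-singular integer matrix is invertible. [cite: Walters1982, §0.8 (held text chunk p0043)] -/
private theorem isUnit_det_map (hA : A.det ≠ 0) : IsUnit (A.map (Int.cast : ℤ → ℝ)).det := by
  have : (A.map (Int.cast : ℤ → ℝ)).det = (A.det : ℝ) := by
    rw [show (Int.cast : ℤ → ℝ) = Int.castRingHom ℝ from rfl, RingHom.map_det, RingHom.mapMatrix_apply]
  rw [this, isUnit_iff_ne_zero]
  exact_mod_cast hA

include hT in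
/-- **A character `χ_m` with `m ∉ ℤ^d A` is non-trivial on `ker T_A`** (`det A ≠ 0`): the points
`y_j = A_ℝ⁻¹ e_j mod ℤ^d` lie in `ker T_A`, and `χ_m(y_j) = 1` for all `j` forces `m A_ℝ⁻¹ ∈ ℤ^d`, i.e.
`m ∈ ℤ^d A` — the annihilator of `ker T_A` in `ℤ^d = (𝕋^d)^` is the image `ℤ^d A` of the dual endomorphism
(«by duality»). [cite: CuntzVershik2012, §2 (held text arXiv:1202.5960 chunk p0005)]
[cite: Walters1982, §0.8 (held text chunk p0043)] -/
theorem exists_apply_eq_zero_and_mFourier_ne_one (hA : A.det ≠ 0) {m : d → ℤ} (hm : ∀ k : d → ℤ, k ᵥ* A ≠ m) :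
    ∃ y : UnitAddTorus d, T y = 0 ∧ UnitAddTorus.mFourier m y ≠ 1 := by
  by_contra h
  push Not at h
  set Ar : Matrix d d ℝ := A.map (Int.cast : ℤ → ℝ) with hAr
  set B : Matrix d d ℝ := Ar⁻¹ with hB
  have hAB : Ar * B = 1 := mul_nonsing_inv Ar (isUnit_det_map A hA)
  have hBA : B * Ar = 1 := nonsing_inv_mul Ar (isUnit_det_map A hA)
  -- the points `y_j = (B_{ij})_i mod ℤ^d` are killed by `T_A`
  have hker : ∀ j : d, T (fun i ↦ ((B i j : ℝ) : UnitAddCircle)) = 0 := by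
    intro j
    rw [apply_coe A hT]
    funext i
    have h1 : (Ar *ᵥ fun i ↦ B i j) i = (1 : Matrix d d ℝ) i j := by
      rw [← hAB, Matrix.mul_apply, mulVec, dotProduct]
    rw [Pi.zero_apply, h1, AddCircle.coe_eq_zero_iff]
    refine ⟨if i = j then 1 else 0, ?_⟩
    rw [Matrix.one_apply]
    split_ifs <;> simp
  -- hence `χ_m(y_j) = 1`: `(m B)_j ∈ ℤ`
  have hint : ∀ j : d, ∃ p : ℤ, ((fun i ↦ (m i : ℝ)) ᵥ* B) j = p := by
    intro j
    obtain ⟨p, hp⟩ := (ToralTranslation.mFourier_coe_eq_one_iff m fun i ↦ B i j).1 (h _ (hker j))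
    exact ⟨p, by rw [← hp]; rfl⟩
  choose k hk using hint
  refine hm k ?_
  -- `k A = m`, read in `ℝ^d`: `k_ℝ = m_ℝ B`, so `k_ℝ A_ℝ = m_ℝ B A_ℝ = m_ℝ`
  have hkr : (fun j ↦ (k j : ℝ)) = (fun i ↦ (m i : ℝ)) ᵥ* B := funext fun j ↦ (hk j).symm
  funext j
  have h1 : (((k ᵥ* A) j : ℤ) : ℝ) = ((fun j ↦ (k j : ℝ)) ᵥ* Ar) j := by
    rw [hAr, show (Int.cast : ℤ → ℝ) = Int.castRingHom ℝ from rfl, RingHom.map_vecMul]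
    rfl
  have h2 : ((fun j ↦ (k j : ℝ)) ᵥ* Ar) j = (m j : ℝ) := by
    rw [hkr, vecMul_vecMul, hBA, vecMul_one]
  exact_mod_cast h1.trans h2

/-! ### §2 Fourier coefficients of `f ∘ T_A` vanish off `ℤ^d A` -/

include hT in
/-- **`ĉ_m(f ∘ T_A) = 0` for `m ∉ ℤ^d A`** (`det A ≠ 0`, any `f`): `f ∘ T_A` is invariant under translation by
every `y ∈ ker T_A`, so `ĉ_m(f ∘ T_A) = χ_m(y) ĉ_m(f ∘ T_A)` (`ToralTranslation.mFourierCoeff_comp_add_right`),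
and `χ_m(y) ≠ 1` for a suitable `y` (§1).  Together with `ToralEndomorphism.mFourierCoeff_comp`
(`ĉ_{kA}(f ∘ T_A) = ĉ_k(f)`) this is the Fourier transform of «`T⁻¹𝓑` ↔ functions on `G/ker α` ↔ `φ(G)`».
[cite: CuntzVershik2012, §2 (held text arXiv:1202.5960 chunk p0005)]
[cite: Walters1982, §0.8 (held text chunk p0043)] -/
theorem mFourierCoeff_comp_eq_zero (hA : A.det ≠ 0) {E : Type*} [NormedAddCommGroup E] [NormedSpace ℂ E]
    (f : UnitAddTorus d → E) {m : d → ℤ} (hm : ∀ k : d → ℤ, k ᵥ* A ≠ m) :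
    UnitAddTorus.mFourierCoeff (f ∘ T) m = 0 := by
  obtain ⟨y, hy0, hy1⟩ := exists_apply_eq_zero_and_mFourier_ne_one A hT hA hm
  have hinv : (fun x ↦ (f ∘ T) (x + y)) = f ∘ T := by
    funext x
    simp only [Function.comp_apply, map_add_eq' A hT, hy0, add_zero]
  have h := ToralTranslation.mFourierCoeff_comp_add_right (f ∘ T) y m
  rw [hinv] at h
  have h' : (1 - UnitAddTorus.mFourier m y) • UnitAddTorus.mFourierCoeff (f ∘ T) m = 0 := by
    rw [sub_smul, one_smul, ← h, sub_self]
  exact (smul_eq_zero.1 h').resolve_left (sub_ne_zero.2 hy1.symm)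

include hT in
/-- `ĉ_m(f ∘ T_Aⁿ) = 0` for `m ∉ ℤ^d Aⁿ` (`det A ≠ 0`). [cite: CuntzVershik2012, §2 (held text arXiv:1202.5960 chunk p0005)] -/
theorem mFourierCoeff_comp_iterate_eq_zero (hA : A.det ≠ 0) {E : Type*} [NormedAddCommGroup E] [NormedSpace ℂ E]
    (f : UnitAddTorus d → E) {m : d → ℤ} {n : ℕ} (hm : ∀ k : d → ℤ, k ᵥ* A ^ n ≠ m) :
    UnitAddTorus.mFourierCoeff (f ∘ T^[n]) m = 0 :=
  mFourierCoeff_comp_eq_zero (A ^ n) (T := T^[n]) (iterate_apply A hT n) (by rw [det_pow]; exact pow_ne_zero _ hA)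
    f hm

/-! ### §3 `⋂ₙ ℤ^d Aⁿ = 0` ⟹ the tail σ-algebra of `T_A` is trivial -/

omit [DecidableEq d] in
/-- If the indicator function of a set is a.e. equal to a constant, the set is a.e. empty or a.e. everything.
[folklore] -/
private theorem eventuallyConst_of_indicator_ae_eq_const {s : Set (UnitAddTorus d)} {c : ℂ}
    (h : s.indicator (fun _ ↦ (1 : ℂ)) =ᵐ[volume] fun _ ↦ c) : EventuallyConst s (ae volume) := by
  rw [eventuallyConst_set]
  by_cases hc : c = 1
  · left
    filter_upwards [h] with x hx
    by_contra hxs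
    rw [indicator_of_notMem hxs, hc] at hx
    exact zero_ne_one hx
  · right
    filter_upwards [h] with x hx hxs
    rw [indicator_of_mem hxs] at hx
    exact hc hx.symm

include hT in
/-- **The Fourier coefficients of a tail-measurable set vanish off `⋂ₙ ℤ^d Aⁿ`**: if `s ∈ 𝓑_∞(T_A)` and
`m ∉ ℤ^d Aⁿ` for some `n`, then `ĉ_m(1_s) = 0` (`s = T_A⁻ⁿ t`, `1_s = 1_t ∘ T_Aⁿ`, §2).
[cite: CuntzVershik2012, §2 (held text arXiv:1202.5960 chunk p0005)] [cite: Walters1982, §4.9 Definition 4.14 (held text chunk p0126)] -/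
theorem mFourierCoeff_indicator_eq_zero_of_measurableSet_tail (hA : A.det ≠ 0) {s : Set (UnitAddTorus d)}
    (hs : MeasurableSet[tailMeasurableSpace T] s) {m : d → ℤ} {n : ℕ} (hm : ∀ k : d → ℤ, k ᵥ* A ^ n ≠ m) :
    UnitAddTorus.mFourierCoeff (s.indicator fun _ ↦ (1 : ℂ)) m = 0 := by
  obtain ⟨t, -, rfl⟩ := measurableSet_tailMeasurableSpace_iff.1 hs n
  have hind : (T^[n] ⁻¹' t).indicator (fun _ ↦ (1 : ℂ)) = (t.indicator fun _ ↦ (1 : ℂ)) ∘ T^[n] :=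
    funext fun x ↦ indicator_comp_right (T^[n]) (s := t) (g := fun _ ↦ (1 : ℂ))
  rw [hind]
  exact mFourierCoeff_comp_iterate_eq_zero A hT hA _ hm

include hT in
/-- **Rohlin's criterion, ⇐ on `𝕋^d`.** If `det A ≠ 0` and every non-zero `m ∈ ℤ^d` lies outside `ℤ^d Aⁿ` for
some `n` (i.e. `⋂ₙ ℤ^d Aⁿ = {0}`), then the tail σ-algebra of `T_A` is trivial: a tail-measurable set has all its
Fourier coefficients `ĉ_m(1_s)`, `m ≠ 0`, equal to `0`, so `1_s` is a.e. constant.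
[cite: CuntzVershik2012, §2 (held text arXiv:1202.5960 chunk p0005)] [cite: Walters1982, §4.9 Definition 4.14 (held text chunk p0126)] -/
theorem isTailTrivial_of_forall_exists (hA : A.det ≠ 0)
    (h : ∀ m : d → ℤ, m ≠ 0 → ∃ n : ℕ, ∀ k : d → ℤ, k ᵥ* A ^ n ≠ m) : IsTailTrivial T volume := by
  refine ⟨fun s hs ↦ ?_⟩
  have hsm : MeasurableSet s := measurableSet_of_tailMeasurableSpace hs
  have hmem : MemLp (s.indicator fun _ ↦ (1 : ℂ)) 2 (volume : Measure (UnitAddTorus d)) :=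
    memLp_indicator_const 2 hsm (1 : ℂ) (Or.inr (measure_ne_top _ s))
  have hzero : ∀ m : d → ℤ, m ≠ 0 → UnitAddTorus.mFourierCoeff (s.indicator fun _ ↦ (1 : ℂ)) m = 0 := by
    intro m hm
    obtain ⟨n, hn⟩ := h m hm
    exact mFourierCoeff_indicator_eq_zero_of_measurableSet_tail A hT hA hs hn
  exact eventuallyConst_of_indicator_ae_eq_const
    (ToralTranslation.ae_eq_const_of_forall_mFourierCoeff_eq_zero hmem hzero)

include hT in
/-- **Rohlin's criterion, ⇐: `⋂ₙ ℤ^d Aⁿ = 0 ⟹ T_A` is an exact endomorphism** of `(𝕋^d, Haar)` (`det A ≠ 0`).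
[cite: CuntzVershik2012, §2 (held text arXiv:1202.5960 chunk p0005)] [cite: Walters1982, §4.9 Definition 4.14 (held text chunk p0126)] -/
theorem isExactEndomorphism_of_forall_exists (hA : A.det ≠ 0)
    (h : ∀ m : d → ℤ, m ≠ 0 → ∃ n : ℕ, ∀ k : d → ℤ, k ᵥ* A ^ n ≠ m) : IsExactEndomorphism T volume :=
  ⟨measurePreserving A hT hA, isTailTrivial_of_forall_exists A hT hA h⟩

/-! ### §4 `0 ≠ m ∈ ⋂ₙ ℤ^d Aⁿ` ⟹ the character `χ_m` is tail-measurable and `T_A` is not exact -/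

include hT in
/-- **A character `χ_m` with `m ∈ ⋂ₙ ℤ^d Aⁿ` is `𝓑_∞(T_A)`-measurable**: `m = k_n Aⁿ` gives
`χ_m = χ_{k_n} ∘ T_Aⁿ`, so `χ_m⁻¹(U) = T_A⁻ⁿ(χ_{k_n}⁻¹(U)) ∈ T_A⁻ⁿ𝓑` for every `n`.
[cite: CuntzVershik2012, §2 (held text arXiv:1202.5960 chunk p0005)] [cite: Walters1982, §4.9 Definition 4.14 (held text chunk p0126)] -/
theorem measurableSet_tail_preimage_mFourier {m : d → ℤ} (hm : ∀ n : ℕ, ∃ k : d → ℤ, k ᵥ* A ^ n = m)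
    {U : Set ℂ} (hU : MeasurableSet U) :
    MeasurableSet[tailMeasurableSpace T] (UnitAddTorus.mFourier m ⁻¹' U) := by
  refine measurableSet_tailMeasurableSpace_iff.2 fun n ↦ ?_
  obtain ⟨k, hk⟩ := hm n
  refine ⟨UnitAddTorus.mFourier k ⁻¹' U, (UnitAddTorus.mFourier k).continuous.measurable hU, ?_⟩
  ext x
  simp only [Set.mem_preimage, mFourier_iterate_apply A hT k n x, hk]

omit [DecidableEq d] in
/-- A non-trivial character takes the value `−1` (at `e_j / (2 m_j) mod ℤ^d` for an index with `m_j ≠ 0`).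
[cite: Walters1982, §0.8 (held text chunk p0043)] -/
theorem exists_mFourier_eq_neg_one {m : d → ℤ} (hm : m ≠ 0) :
    ∃ y : UnitAddTorus d, UnitAddTorus.mFourier m y = -1 := by
  classical
  obtain ⟨j, hj⟩ : ∃ j, m j ≠ 0 := by
    by_contra h
    push Not at h
    exact hm (funext h)
  set x : d → ℝ := Pi.single j (1 / (2 * (m j : ℝ))) with hx
  refine ⟨fun i ↦ ((x i : ℝ) : UnitAddCircle), ?_⟩
  rw [mFourier_coe]
  have hsum : (∑ i, (m i : ℂ) * ((x i : ℝ) : ℂ)) = 1 / 2 := by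
    rw [Finset.sum_eq_single j]
    · rw [hx, Pi.single_eq_same]
      have : (m j : ℂ) ≠ 0 := by exact_mod_cast hj
      push_cast
      field_simp
    · intro i _ hij
      rw [hx, Pi.single_eq_of_ne hij, Complex.ofReal_zero, mul_zero]
    · intro hj'; exact absurd (Finset.mem_univ j) hj'
  rw [hsum, show (2 * Real.pi * Complex.I * (1 / 2) : ℂ) = Real.pi * Complex.I by ring, Complex.exp_pi_mul_I]

omit [DecidableEq d] in
/-- The Haar probability measure of the torus charges non-empty open sets. [folklore] -/
private theorem isOpenPosMeasure_volume : (volume : Measure (UnitAddTorus d)).IsOpenPosMeasure := by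
  rw [MeasureTheory.volume_pi]
  infer_instance

include hT in
/-- **Rohlin's criterion, ⇒ on `𝕋^d` (contrapositive).** If some `m ≠ 0` lies in every `ℤ^d Aⁿ`, the tail
σ-algebra of `T_A` is NOT trivial: the `𝓑_∞`-measurable open set `{x : Re χ_m(x) < 0}` and the open set
`{x : Re χ_m(x) > 0}` inside its complement are both non-empty (`χ_m` takes the values `−1` and `1`), hence of
positive Haar measure.  No hypothesis on `det A`.
[cite: CuntzVershik2012, §2 (held text arXiv:1202.5960 chunk p0005)] [cite: Walters1982, §4.9 Definition 4.14 (held text chunk p0126)] -/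
theorem not_isTailTrivial_of_forall_exists {m : d → ℤ} (hm0 : m ≠ 0) (hm : ∀ n : ℕ, ∃ k : d → ℤ, k ᵥ* A ^ n = m) :
    ¬ IsTailTrivial T volume := by
  intro h
  haveI := isOpenPosMeasure_volume (d := d)
  set s : Set (UnitAddTorus d) := UnitAddTorus.mFourier m ⁻¹' {z : ℂ | z.re < 0} with hs
  have hUo : IsOpen {z : ℂ | z.re < 0} := isOpen_lt Complex.continuous_re continuous_const
  have hstail : MeasurableSet[tailMeasurableSpace T] s := measurableSet_tail_preimage_mFourier A hT hm hUo.measurableSet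
  have hso : IsOpen s := hUo.preimage (UnitAddTorus.mFourier m).continuous
  -- `s` and the open part of `sᶜ` are non-empty
  obtain ⟨y, hy⟩ := exists_mFourier_eq_neg_one hm0
  have hys : y ∈ s := by
    change (UnitAddTorus.mFourier m y).re < 0
    rw [hy]; norm_num
  have h0s : (0 : UnitAddTorus d) ∈ UnitAddTorus.mFourier m ⁻¹' {z : ℂ | 0 < z.re} := by
    change 0 < (UnitAddTorus.mFourier m 0).re
    have : UnitAddTorus.mFourier m (0 : UnitAddTorus d) = 1 := by
      have h1 := ToralTranslation.mFourier_apply_add m (0 : UnitAddTorus d) 0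
      rw [add_zero] at h1
      have hne : UnitAddTorus.mFourier m (0 : UnitAddTorus d) ≠ 0 := by
        intro h0
        obtain ⟨x, hx⟩ := exists_coe_eq' (0 : UnitAddTorus d)
        rw [← hx, mFourier_coe] at h0
        exact Complex.exp_ne_zero _ h0
      exact (mul_right_eq_self₀.1 h1.symm).resolve_right hne
    rw [this]; norm_num
  have hpos1 : 0 < volume s := hso.measure_pos volume ⟨y, hys⟩
  have hpos2 : 0 < volume sᶜ := by
    refine lt_of_lt_of_le (((isOpen_lt continuous_const Complex.continuous_re).preimage
      (UnitAddTorus.mFourier m).continuous).measure_pos volume ⟨0, h0s⟩) (measure_mono ?_)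
    intro x hx hxs
    change 0 < (UnitAddTorus.mFourier m x).re at hx
    change (UnitAddTorus.mFourier m x).re < 0 at hxs
    exact lt_asymm hx hxs
  rcases isTailTrivial_iff_measure.1 h s hstail with h' | h'
  · exact hpos1.ne' h'
  · exact hpos2.ne' h'
where
  /-- every point of the torus has a lift -/
  exists_coe_eq' (y : UnitAddTorus d) : ∃ x : d → ℝ, (fun i ↦ ((x i : ℝ) : UnitAddCircle)) = y :=
    ⟨fun i ↦ Classical.choose (QuotientAddGroup.mk_surjective (y i)),
      funext fun i ↦ Classical.choose_spec (QuotientAddGroup.mk_surjective (y i))⟩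

include hT in
/-- `0 ≠ m ∈ ⋂ₙ ℤ^d Aⁿ ⟹ T_A` is not an exact endomorphism. [cite: CuntzVershik2012, §2 (held text arXiv:1202.5960 chunk p0005)] -/
theorem not_isExactEndomorphism_of_forall_exists {m : d → ℤ} (hm0 : m ≠ 0)
    (hm : ∀ n : ℕ, ∃ k : d → ℤ, k ᵥ* A ^ n = m) : ¬ IsExactEndomorphism T volume :=
  fun h ↦ not_isTailTrivial_of_forall_exists A hT hm0 hm h.isTailTrivial

/-! ### §5 Rohlin's criterion on the torus: `T_A` exact ⟺ `⋂ₙ ℤ^d Aⁿ = 0` -/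

include hT in
/-- **Rohlin's criterion on `𝕋^d` (Cuntz–Vershik §2): for a non-singular integer matrix `A`, the tail σ-algebra of
`T_A : x ↦ Ax mod ℤ^d` is trivial for the Haar measure iff `⋂ₙ ℤ^d Aⁿ = {0}`**, i.e. iff every non-zero integer
row vector `m` lies outside `ℤ^d Aⁿ = {k Aⁿ}` for some `n` (the dual endomorphism `φ(k) = kA` of `ℤ^d = (𝕋^d)^`
has `⋂ₙ φⁿ(ℤ^d) = 0`; by duality, `⋃ₙ ker T_Aⁿ` is dense).
[cite: CuntzVershik2012, §2 (held text arXiv:1202.5960 chunk p0005)] [cite: Walters1982, §4.9 Definition 4.14 (held text chunk p0126)] -/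
theorem isTailTrivial_iff_forall_exists (hA : A.det ≠ 0) :
    IsTailTrivial T volume ↔ ∀ m : d → ℤ, m ≠ 0 → ∃ n : ℕ, ∀ k : d → ℤ, k ᵥ* A ^ n ≠ m := by
  refine ⟨fun h m hm0 ↦ ?_, isTailTrivial_of_forall_exists A hT hA⟩
  by_contra hc
  push Not at hc
  exact not_isTailTrivial_of_forall_exists A hT hm0 hc h

include hT in
/-- **Rohlin's criterion on `𝕋^d`: for `det A ≠ 0`, `T_A` is an exact endomorphism of `(𝕋^d, Haar)` iff
`⋂ₙ ℤ^d Aⁿ = {0}`.** [cite: CuntzVershik2012, §2 (held text arXiv:1202.5960 chunk p0005)]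
[cite: Walters1982, §4.9 Definition 4.14 (held text chunk p0126)] -/
theorem isExactEndomorphism_iff_forall_exists (hA : A.det ≠ 0) :
    IsExactEndomorphism T volume ↔ ∀ m : d → ℤ, m ≠ 0 → ∃ n : ℕ, ∀ k : d → ℤ, k ᵥ* A ^ n ≠ m := by
  rw [isExactEndomorphism_iff, isTailTrivial_iff_forall_exists A hT hA]
  exact ⟨fun h ↦ h.2, fun h ↦ ⟨measurePreserving A hT hA, h⟩⟩

/-! ### §6 The lattice `⋂ₙ ℤ^d Aⁿ` and the unimodular factors of `χ_A` -/

section Algebra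

/-- `p(A)` commutes with `q(A)`. [folklore] -/
private theorem aeval_mul_comm (p q : ℤ[X]) : aeval A p * aeval A q = aeval A q * aeval A p := by
  rw [← map_mul, mul_comm, map_mul]

/-- **A unimodular factor of `χ_A` is singular at `A`**: if `g ∣ χ_A` with `deg g ≥ 1` then `det g(A) = 0`
(over `ℂ`, `det g(A) = ∏_j g(λ_j)` over the eigenvalues `λ_j`, and a root of `g` is one of them).
[cite: AndersenThomsen2012, §4 Theorem 4.1 (held text arXiv:1204.0224 chunk p0010)] -/
theorem det_aeval_eq_zero_of_dvd_charpoly {g : ℤ[X]} (hdeg : 0 < g.natDegree) (hdvd : g ∣ A.charpoly) :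
    (aeval A g).det = 0 := by
  have hinj : Function.Injective (Int.castRingHom ℂ) := Int.cast_injective
  rw [← map_eq_zero_iff (Int.castRingHom ℂ) hinj, RingHom.map_det, RingHom.mapMatrix_apply]
  -- `g(A)` maps to `g_ℂ(A_ℂ)`
  have hmap : (aeval A g).map (Int.castRingHom ℂ) = aeval (A.map (Int.castRingHom ℂ)) (g.map (Int.castRingHom ℂ)) := by
    have h := map_aeval_eq_aeval_map (R := ℤ) (S := Matrix d d ℤ) (T := ℂ) (U := Matrix d d ℂ)
      (φ := Int.castRingHom ℂ) (ψ := (Int.castRingHom ℂ).mapMatrix) (Subsingleton.elim _ _) g A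
    simp only [RingHom.mapMatrix_apply] at h
    exact h
  rw [hmap, Literature.LinearAlgebra.AevalEigenvalues.matrix_det_aeval, Multiset.prod_eq_zero_iff, Multiset.mem_map]
  -- a root of `g_ℂ` is an eigenvalue
  have hdeg' : 0 < (g.map (Int.castRingHom ℂ)).degree := by
    rw [degree_map_eq_of_injective hinj, ← natDegree_pos_iff_degree_pos]; exact hdeg
  obtain ⟨β, hβ⟩ := Complex.exists_root hdeg'
  refine ⟨β, ?_, hβ⟩
  rw [mem_roots (charpoly_monic _).ne_zero, charpoly_map]
  exact eval_eq_zero_of_dvd_of_eval_eq_zero (Polynomial.map_dvd (Int.castRingHom ℂ) hdvd) hβ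

/-- **`ker_ℤ g(A)` is carried onto itself by `·A` when `g(0) = ±1`**: from `g = X q + c`, `v g(A) = 0` gives
`c v = −(v q(A)) A`, and `u = −c (v q(A))` has `u g(A) = 0`, `u A = v`.
[cite: AndersenThomsen2012, §4 Theorem 4.1 (held text arXiv:1204.0224 chunk p0010)] -/
theorem exists_vecMul_eq_of_vecMul_aeval_eq_zero {g : ℤ[X]} (h0 : IsUnit (g.coeff 0)) {v : d → ℤ}
    (hv : v ᵥ* aeval A g = 0) : ∃ u : d → ℤ, u ᵥ* aeval A g = 0 ∧ u ᵥ* A = v := by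
  set c : ℤ := g.coeff 0 with hc
  set q : ℤ[X] := divX g with hq
  have hg : g = X * q + C c := (X_mul_divX_add g).symm
  have hcc : c * c = 1 := Int.isUnit_mul_self h0
  -- `v g(A) = (v A) q(A) + c • v`
  have hexp : v ᵥ* aeval A g = (v ᵥ* A) ᵥ* aeval A q + c • v := by
    conv_lhs => rw [hg]
    rw [map_add, map_mul, aeval_X, aeval_C, vecMul_add, ← vecMul_vecMul, Algebra.algebraMap_eq_smul_one,
      vecMul_smul, vecMul_one]
  refine ⟨(-c) • (v ᵥ* aeval A q), ?_, ?_⟩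
  · rw [smul_vecMul, vecMul_vecMul, aeval_mul_comm A q g, ← vecMul_vecMul, hv, zero_vecMul, smul_zero]
  · have h1 : (v ᵥ* A) ᵥ* aeval A q = -(c • v) := eq_neg_of_add_eq_zero_left (hexp ▸ hv)
    have hcomm : aeval A q * A = A * aeval A q := by
      have h := aeval_mul_comm A q X
      rwa [aeval_X] at h
    rw [smul_vecMul, vecMul_vecMul, hcomm, ← vecMul_vecMul, h1, smul_neg, neg_smul, neg_neg, smul_smul, hcc,
      one_smul]

/-- **A unimodular factor of `χ_A` puts a non-zero vector in `⋂ₙ ℤ^d Aⁿ`** («if» of Krzyżewski's theorem, in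
Rohlin's form): for `g ∈ ℤ[X]` of positive degree with `g(0) = ±1` and `g ∣ χ_A` (monicity is not needed), the lattice
`K = {v ∈ ℤ^d : v g(A) = 0}` is non-zero (`det g(A) = 0`) and satisfies `K ⊆ K A`, hence `K ⊆ ℤ^d Aⁿ` for all `n`.
[cite: AndersenThomsen2012, §4 Theorem 4.1 (held text arXiv:1204.0224 chunk p0010)]
[cite: Krzyzewski1993, Theorem (abstract)] -/
theorem exists_ne_zero_forall_exists_of_dvd_charpoly {g : ℤ[X]} (hdeg : 0 < g.natDegree)
    (h0 : IsUnit (g.coeff 0)) (hdvd : g ∣ A.charpoly) :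
    ∃ m : d → ℤ, m ≠ 0 ∧ ∀ n : ℕ, ∃ k : d → ℤ, k ᵥ* A ^ n = m := by
  obtain ⟨m, hm0, hm⟩ := Matrix.exists_vecMul_eq_zero_iff.2 (det_aeval_eq_zero_of_dvd_charpoly A hdeg hdvd)
  refine ⟨m, hm0, fun n ↦ ?_⟩
  -- induction inside `K = ker_ℤ g(A)`
  suffices H : ∀ v : d → ℤ, v ᵥ* aeval A g = 0 → ∃ k : d → ℤ, k ᵥ* aeval A g = 0 ∧ k ᵥ* A ^ n = v by
    obtain ⟨k, -, hk⟩ := H m hm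
    exact ⟨k, hk⟩
  induction n with
  | zero => exact fun v hv ↦ ⟨v, hv, by rw [pow_zero, vecMul_one]⟩
  | succ n ih =>
    intro v hv
    obtain ⟨k, hk, hkv⟩ := ih v hv
    obtain ⟨u, hu, huk⟩ := exists_vecMul_eq_of_vecMul_aeval_eq_zero A h0 hk
    exact ⟨u, hu, by rw [pow_succ', ← vecMul_vecMul, huk, hkv]⟩

/-- The lattice `L_∞ = ⋂ₙ ℤ^d Aⁿ` is the `ℤ`-submodule `⨅ₙ range(· ᵥ* Aⁿ)` of `ℤ^d`.
[cite: CuntzVershik2012, §2 (held text arXiv:1202.5960 chunk p0005)] -/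
private theorem mem_iInf_range_vecMulLinear_iff {v : d → ℤ} :
    v ∈ (⨅ n : ℕ, LinearMap.range (Matrix.vecMulLinear (A ^ n)) : Submodule ℤ (d → ℤ)) ↔
      ∀ n : ℕ, ∃ k : d → ℤ, k ᵥ* A ^ n = v := by
  simp only [Submodule.mem_iInf, LinearMap.mem_range, Matrix.vecMulLinear_apply]

/-- `L_∞ A ⊆ L_∞`. [cite: CuntzVershik2012, §2 (held text arXiv:1202.5960 chunk p0005)] -/
private theorem forall_exists_vecMul_vecMul {v : d → ℤ} (hv : ∀ n : ℕ, ∃ k : d → ℤ, k ᵥ* A ^ n = v) :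
    ∀ n : ℕ, ∃ k : d → ℤ, k ᵥ* A ^ n = v ᵥ* A := by
  intro n
  obtain ⟨k, hk⟩ := hv n
  exact ⟨k ᵥ* A, by rw [vecMul_vecMul, ← pow_succ', pow_succ, ← vecMul_vecMul, hk]⟩

/-- `L_∞ ⊆ L_∞ A` for `det A ≠ 0` (the dual action is injective). [cite: CuntzVershik2012, §2 (held text arXiv:1202.5960 chunk p0005)] -/
private theorem exists_forall_exists_vecMul_eq (hA : A.det ≠ 0) {v : d → ℤ}
    (hv : ∀ n : ℕ, ∃ k : d → ℤ, k ᵥ* A ^ n = v) :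
    ∃ u : d → ℤ, (∀ n : ℕ, ∃ k : d → ℤ, k ᵥ* A ^ n = u) ∧ u ᵥ* A = v := by
  obtain ⟨u, hu⟩ := hv 1
  rw [pow_one] at hu
  refine ⟨u, fun n ↦ ?_, hu⟩
  obtain ⟨k, hk⟩ := hv (n + 1)
  refine ⟨k, vecMul_injective A hA ?_⟩
  change (k ᵥ* A ^ n) ᵥ* A = u ᵥ* A
  rw [vecMul_vecMul, ← pow_succ, hk, hu]

/-- The characteristic polynomial of an invariant subspace divides the characteristic polynomial (block-triangular
form in a basis adapted to a complement). [folklore] -/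
private theorem charpoly_toMatrix_restrict_dvd {K V : Type*} [Field K] [AddCommGroup V] [Module K V]
    [FiniteDimensional K V] (φ : V →ₗ[K] V) {W : Submodule K V} (hW : ∀ w ∈ W, φ w ∈ W) {ι : Type*} [Fintype ι]
    [DecidableEq ι] (bW : Module.Basis ι K W) :
    (LinearMap.toMatrix bW bW (φ.restrict hW)).charpoly ∣ φ.charpoly := by
  classical
  obtain ⟨W', hWW'⟩ := Submodule.exists_isCompl W
  let bW' := Module.Free.chooseBasis K W'
  let e : (W × W') ≃ₗ[K] V := Submodule.prodEquivOfIsCompl W W' hWW'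
  let B : Module.Basis (ι ⊕ Module.Free.ChooseBasisIndex K W') K V := (bW.prod bW').map e
  -- the columns of `[φ]_B` through `W`: `φ(b_i) = e (φ|_W b_i, 0)`
  have hrepr : ∀ i, B.repr (φ (B (Sum.inl i))) = (bW.prod bW').repr (φ.restrict hW (bW i), 0) := by
    intro i
    have hBl : B (Sum.inl i) = (bW i : V) := by
      simp only [B, e, Module.Basis.map_apply, Submodule.coe_prodEquivOfIsCompl', Module.Basis.prod_apply_inl_fst,
        Module.Basis.prod_apply_inl_snd, Submodule.coe_zero, add_zero]
    have h1 : φ (B (Sum.inl i)) = e (φ.restrict hW (bW i), 0) := by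
      rw [hBl, Submodule.coe_prodEquivOfIsCompl', Submodule.coe_zero, add_zero, LinearMap.coe_restrict_apply]
    rw [h1]
    change ((bW.prod bW').map e).repr (e _) = _
    rw [Module.Basis.map_repr, LinearEquiv.trans_apply, LinearEquiv.symm_apply_apply]
  -- so `[φ]_B` is block upper triangular with upper-left block `[φ|_W]_{bW}`
  set N := LinearMap.toMatrix B B φ with hN
  have h21 : N.toBlocks₂₁ = 0 := by
    ext a i
    simp only [toBlocks₂₁, of_apply, hN, LinearMap.toMatrix_apply, hrepr, Module.Basis.prod_repr_inr, map_zero,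
      Finsupp.coe_zero, Pi.zero_apply, Matrix.zero_apply]
  have h11 : N.toBlocks₁₁ = LinearMap.toMatrix bW bW (φ.restrict hW) := by
    ext j i
    simp only [toBlocks₁₁, of_apply, hN, LinearMap.toMatrix_apply, hrepr, Module.Basis.prod_repr_inl]
  rw [← LinearMap.charpoly_toMatrix φ B, ← hN, ← fromBlocks_toBlocks N, h21, h11, charpoly_fromBlocks_zero₂₁]
  exact dvd_mul_right _ _

/-- **A non-zero `⋂ₙ ℤ^d Aⁿ` produces a unimodular factor of `χ_A`** («only if» of Krzyżewski's theorem, in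
Rohlin's form): for `det A ≠ 0`, `L_∞ = ⋂ₙ ℤ^d Aⁿ` is a lattice with `L_∞ A = L_∞`; in a `ℤ`-basis of `L_∞` the
map `v ↦ vA` is an integer matrix `M` of determinant `±1`, and `g = χ_M` is monic of degree `rk L_∞ ≥ 1` with
`g(0) = ±det M = ±1` and `g ∣ χ_A` (block-triangular form of `·A` on `ℚ^d = ℚ L_∞ ⊕ W'`).
[cite: AndersenThomsen2012, §4 Theorem 4.1 (held text arXiv:1204.0224 chunk p0010)]
[cite: Krzyzewski1993, Theorem (abstract)] -/
theorem exists_unimodular_dvd_charpoly (hA : A.det ≠ 0) {m : d → ℤ} (hm0 : m ≠ 0)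
    (hm : ∀ n : ℕ, ∃ k : d → ℤ, k ᵥ* A ^ n = m) :
    ∃ g : ℤ[X], g.Monic ∧ 0 < g.natDegree ∧ IsUnit (g.coeff 0) ∧ g ∣ A.charpoly := by
  classical
  -- the lattice `L = L_∞ = ⋂ₙ ℤ^d Aⁿ`
  set L : Submodule ℤ (d → ℤ) := ⨅ n : ℕ, LinearMap.range (Matrix.vecMulLinear (A ^ n)) with hL
  have hmL : ∀ {v : d → ℤ}, v ∈ L ↔ ∀ n : ℕ, ∃ k : d → ℤ, k ᵥ* A ^ n = v := fun {v} ↦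
    mem_iInf_range_vecMulLinear_iff A
  -- `ψ = ·A` on `L`, a bijection
  let φ : (d → ℤ) →ₗ[ℤ] (d → ℤ) := Matrix.vecMulLinear A
  have hφL : ∀ v ∈ L, φ v ∈ L := fun v hv ↦ by
    rw [Matrix.vecMulLinear_apply]; exact hmL.2 (forall_exists_vecMul_vecMul A (hmL.1 hv))
  let ψ : L →ₗ[ℤ] L := φ.restrict hφL
  have hψsurj : Surjective ψ := by
    rintro ⟨v, hv⟩
    obtain ⟨u, hu, huv⟩ := exists_forall_exists_vecMul_eq A hA (hmL.1 hv)
    exact ⟨⟨u, hmL.2 hu⟩, Subtype.ext (by rw [LinearMap.coe_restrict_apply, Matrix.vecMulLinear_apply]; exact huv)⟩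
  have hψbij : Bijective ψ := OrzechProperty.bijective_of_surjective_endomorphism ψ hψsurj
  -- a `ℤ`-basis of `L`, of positive rank
  obtain ⟨r, b⟩ := Submodule.basisOfPid (Pi.basisFun ℤ d) L
  have hr : 0 < r := by
    by_contra hr0
    have hr0' : r = 0 := Nat.eq_zero_of_not_pos hr0
    subst hr0'
    have hmL0 : (⟨m, hmL.2 hm⟩ : L) = 0 := b.repr.injective (Subsingleton.elim _ _)
    exact hm0 (congrArg Subtype.val hmL0)
  set M : Matrix (Fin r) (Fin r) ℤ := LinearMap.toMatrix b b ψ with hM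
  have hMdet : IsUnit M.det := by
    rw [hM, LinearMap.det_toMatrix]
    exact LinearMap.isUnit_det ψ ((Module.End.isUnit_iff ψ).2 hψbij)
  refine ⟨M.charpoly, charpoly_monic M, ?_, ?_, ?_⟩
  · rw [charpoly_natDegree_eq_dim, Fintype.card_fin]; exact hr
  · have h := det_eq_sign_charpoly_coeff M
    have h' : M.charpoly.coeff 0 = (-1) ^ Fintype.card (Fin r) * M.det := by
      rw [h, ← mul_assoc, ← pow_add, ← two_mul, pow_mul, neg_one_sq, one_pow, one_mul]
    rw [h']
    exact ((isUnit_one.neg).pow _).mul hMdet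
  · -- divisibility over `ℚ`: `·A_ℚ` on `ℚ^d` preserves `W = ℚ L`, with matrix `M` in the basis `b`
    let c : (d → ℤ) →ₗ[ℤ] (d → ℚ) := ((Int.castRingHom ℚ).compLeft d).toIntLinearMap
    have hc : ∀ v : d → ℤ, c v = fun i ↦ (v i : ℚ) := fun v ↦ rfl
    set Aq : Matrix d d ℚ := A.map (Int.castRingHom ℚ) with hAq
    let φq : (d → ℚ) →ₗ[ℚ] (d → ℚ) := Matrix.vecMulLinear Aq
    have hφq : ∀ v : d → ℤ, φq (c v) = c (v ᵥ* A) := fun v ↦ by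
      rw [Matrix.vecMulLinear_apply, hc, hc]
      funext j
      exact (RingHom.map_vecMul (Int.castRingHom ℚ) A v j).symm
    -- the family `w_i = b_i ∈ ℚ^d` is linearly independent over `ℚ`
    let w : Fin r → (d → ℚ) := fun i ↦ c (b i : d → ℤ)
    have hwZ : LinearIndependent ℤ w := by
      have h1 : LinearIndependent ℤ (fun i ↦ (b i : d → ℤ)) := b.linearIndependent.map' L.subtype L.ker_subtype
      refine h1.map' c ?_
      rw [LinearMap.ker_eq_bot]
      intro u v huv
      funext i
      have := congrFun huv i
      simp only [hc] at this
      exact_mod_cast this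
    have hwQ : LinearIndependent ℚ w := (LinearIndependent.iff_fractionRing ℤ ℚ).1 hwZ
    set W : Submodule ℚ (d → ℚ) := Submodule.span ℚ (Set.range w) with hW
    let bW : Module.Basis (Fin r) ℚ W := Module.Basis.span hwQ
    have hbW : ∀ i, (bW i : d → ℚ) = w i := fun i ↦ congrArg Subtype.val (Module.Basis.span_apply hwQ i)
    -- `φq (w i) = Σ_j M_{ji} w_j`
    have hψb : ∀ i, ((ψ (b i) : L) : d → ℤ) = ∑ j, M j i • (b j : d → ℤ) := by
      intro i
      have h1 : ψ (b i) = ∑ j, M j i • b j := by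
        have h := Matrix.toLin_self (v₁ := b) (v₂ := b) (LinearMap.toMatrix b b ψ) i
        rw [Matrix.toLin_toMatrix] at h
        exact h
      rw [h1, Submodule.coe_sum]
      exact sum_congr rfl fun j _ ↦ by rw [Submodule.coe_smul]
    have hφw : ∀ i, φq (w i) = ∑ j, (M j i : ℚ) • w j := by
      intro i
      change φq (c (b i : d → ℤ)) = _
      rw [hφq]
      have h2 : (b i : d → ℤ) ᵥ* A = ((ψ (b i) : L) : d → ℤ) := by
        rw [LinearMap.coe_restrict_apply, Matrix.vecMulLinear_apply]
      rw [h2, hψb, _root_.map_sum]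
      refine sum_congr rfl fun j _ ↦ ?_
      rw [map_zsmul, Int.cast_smul_eq_zsmul]
    have hWst : ∀ x ∈ W, φq x ∈ W := by
      intro x hx
      refine Submodule.span_induction (p := fun x _ ↦ φq x ∈ W) ?_ ?_ ?_ ?_ hx
      · rintro _ ⟨i, rfl⟩
        rw [hφw]
        exact Submodule.sum_mem _ fun j _ ↦ Submodule.smul_mem _ _ (Submodule.subset_span ⟨j, rfl⟩)
      · rw [map_zero]; exact W.zero_mem
      · intro x y _ _ hx hy; rw [map_add]; exact W.add_mem hx hy
      · intro a x _ hx; rw [map_smul]; exact W.smul_mem a hx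
    -- the matrix of `φq|_W` in the basis `bW` is `M`
    have hMq : LinearMap.toMatrix bW bW (φq.restrict hWst) = M.map (Int.castRingHom ℚ) := by
      have h1 : φq.restrict hWst = Matrix.toLin bW bW (M.map (Int.castRingHom ℚ)) := by
        refine bW.ext fun i ↦ Subtype.ext ?_
        rw [LinearMap.coe_restrict_apply, Matrix.toLin_self, hbW, hφw, Submodule.coe_sum]
        refine sum_congr rfl fun j _ ↦ ?_
        rw [Submodule.coe_smul, hbW, Matrix.map_apply, eq_intCast]
      rw [h1, LinearMap.toMatrix_toLin]
    -- `χ_{M} ∣ χ_{φq} = χ_{A}` over `ℚ`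
    have hdvdQ : (M.map (Int.castRingHom ℚ)).charpoly ∣ Aq.charpoly := by
      have h1 := charpoly_toMatrix_restrict_dvd φq hWst bW
      rw [hMq] at h1
      have h2 : φq.charpoly = Aq.charpoly := by
        have hφq' : φq = Matrix.toLin' Aqᵀ := by
          change Matrix.vecMulLinear Aq = _
          rw [Matrix.toLin'_apply', ← Matrix.vecMulLinear_transpose, transpose_transpose]
        rw [← LinearMap.charpoly_toMatrix φq (Pi.basisFun ℚ d), LinearMap.toMatrix_eq_toMatrix', hφq',
          LinearMap.toMatrix'_toLin', charpoly_transpose]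
      rwa [h2] at h1
    rw [charpoly_map, hAq, charpoly_map] at hdvdQ
    exact (Polynomial.map_dvd_map (Int.castRingHom ℚ) (Int.castRingHom ℚ).injective_int (charpoly_monic M)).1 hdvdQ

end Algebra

/-! ### §7 Krzyżewski's theorem and its corollaries -/

include hT in
/-- **Krzyżewski's theorem (Andersen–Thomsen, Theorem 4.1).** For a non-singular integer matrix `A`, the
endomorphism `T_A : x ↦ Ax mod ℤ^d` of `𝕋^d = (ℝ/ℤ)^d` is an exact endomorphism (Walters Def. 4.14, Haar
probability measure) **iff no unimodular polynomial divides the characteristic polynomial `χ_A`** — unimodular: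
monic, integer coefficients, positive degree, constant term `±1`.
[cite: AndersenThomsen2012, §4 Theorem 4.1 and §2.5 Proposition 2.9 (held text arXiv:1204.0224 chunks p0010, p0007)]
[cite: Krzyzewski1993, Theorem (abstract)] -/
theorem isExactEndomorphism_iff_forall_not_dvd_charpoly (hA : A.det ≠ 0) :
    IsExactEndomorphism T volume ↔
      ∀ g : ℤ[X], g.Monic → 0 < g.natDegree → IsUnit (g.coeff 0) → ¬ g ∣ A.charpoly := by
  rw [isExactEndomorphism_iff_forall_exists A hT hA]
  constructor
  · intro h g _ hdeg h0 hdvd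
    obtain ⟨m, hm0, hm⟩ := exists_ne_zero_forall_exists_of_dvd_charpoly A hdeg h0 hdvd
    obtain ⟨n, hn⟩ := h m hm0
    obtain ⟨k, hk⟩ := hm n
    exact hn k hk
  · intro h m hm0
    by_contra hc
    push Not at hc
    obtain ⟨g, hmonic, hdeg, h0, hdvd⟩ := exists_unimodular_dvd_charpoly A hA hm0 hc
    exact h g hmonic hdeg h0 hdvd

include hT in
/-- **Automorphisms are never exact**: if `det A = ±1` (and `d ≠ ∅`) then `χ_A` itself is unimodular, so `T_A`
is not an exact endomorphism («exact endomorphisms are as far from being invertible as possible»).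
[cite: AndersenThomsen2012, §4 Theorem 4.1 (held text arXiv:1204.0224 chunk p0010)]
[cite: Walters1982, §4.9 Definition 4.14 and the remark after it (held text chunk p0126)] -/
theorem not_isExactEndomorphism_of_isUnit_det [Nonempty d] (hA : IsUnit A.det) : ¬ IsExactEndomorphism T volume := by
  rw [isExactEndomorphism_iff_forall_not_dvd_charpoly A hT hA.ne_zero]
  intro h
  refine h A.charpoly (charpoly_monic A) ?_ ?_ dvd_rfl
  · rw [charpoly_natDegree_eq_dim]; exact Fintype.card_pos
  · have h1 := det_eq_sign_charpoly_coeff A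
    have h' : A.charpoly.coeff 0 = (-1) ^ Fintype.card d * A.det := by
      rw [h1, ← mul_assoc, ← pow_add, ← two_mul, pow_mul, neg_one_sq, one_pow, one_mul]
    rw [h']
    exact ((isUnit_one.neg).pow _).mul hA

omit [Fintype d] [DecidableEq d] in
/-- `‖∏ s‖ ≥ 1` for a multiset of complex numbers of modulus `≥ 1`. [folklore] -/
private theorem one_le_norm_multiset_prod {s : Multiset ℂ} (h : ∀ x ∈ s, 1 ≤ ‖x‖) : 1 ≤ ‖s.prod‖ := by
  induction s using Multiset.induction_on with
  | empty => simp
  | cons a s ih =>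
    rw [Multiset.prod_cons, norm_mul]
    exact one_le_mul_of_one_le_of_one_le (h a (Multiset.mem_cons_self _ _))
      (ih fun x hx ↦ h x (Multiset.mem_cons_of_mem hx))

/-- If every complex eigenvalue of `A` has modulus `> 1` then `det A ≠ 0` (`0` is not an eigenvalue).
[cite: AndersenThomsen2012, §4 remark after Theorem 4.3, «when all the eigenvalues … have modulus greater than 1» (held text arXiv:1204.0224 chunk p0014)] -/
theorem det_ne_zero_of_forall_one_lt_norm (hexp : ∀ α ∈ (A.map (Int.castRingHom ℂ)).charpoly.roots, 1 < ‖α‖) :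
    A.det ≠ 0 := by
  intro hdet
  have h0 : (0 : ℂ) ∈ (A.map (Int.castRingHom ℂ)).charpoly.roots := by
    rw [mem_roots (charpoly_monic _).ne_zero, IsRoot, ← coeff_zero_eq_eval_zero]
    have h1 := det_eq_sign_charpoly_coeff (A.map (Int.castRingHom ℂ))
    rw [← RingHom.mapMatrix_apply, ← RingHom.map_det, hdet, map_zero] at h1
    exact (mul_eq_zero.1 h1.symm).resolve_left (pow_ne_zero _ (neg_ne_zero.2 one_ne_zero))
  have := hexp 0 h0
  rw [norm_zero] at this
  exact absurd this (by norm_num)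

include hT in
/-- **Expanding endomorphisms are exact**: if every complex eigenvalue of `A` has modulus `> 1` then `T_A` is an
exact endomorphism — a unimodular factor `g` of `χ_A` would have all its complex roots of modulus `> 1` and at
least one root, whereas `|g(0)| = ∏ |roots| = 1`.
[cite: AndersenThomsen2012, §4 Theorem 4.1 / Theorem 4.3 (1) and the remark «when all the eigenvalues … have modulus greater than 1 we recover Corollary 4.12 from [EHR]» (held text arXiv:1204.0224 chunks p0010, p0014)]
[cite: Krzyzewski1993, Theorem (abstract)] -/
theorem isExactEndomorphism_of_forall_one_lt_norm
    (hexp : ∀ α ∈ (A.map (Int.castRingHom ℂ)).charpoly.roots, 1 < ‖α‖) : IsExactEndomorphism T volume := by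
  have hA := det_ne_zero_of_forall_one_lt_norm A hexp
  rw [isExactEndomorphism_iff_forall_not_dvd_charpoly A hT hA]
  intro g hmonic hdeg h0 hdvd
  have hinj : Function.Injective (Int.castRingHom ℂ) := Int.cast_injective
  set gc : ℂ[X] := g.map (Int.castRingHom ℂ) with hgc
  have hgcm : gc.Monic := hmonic.map _
  have hsplit : gc.Splits := IsAlgClosed.splits gc
  -- the roots of `g_ℂ` are eigenvalues, of modulus `> 1`
  have hroots : ∀ β ∈ gc.roots, 1 < ‖β‖ := fun β hβ ↦ hexp β
    (Multiset.mem_of_le (roots.le_of_dvd (charpoly_monic _).ne_zero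
      (by rw [charpoly_map]; exact Polynomial.map_dvd (Int.castRingHom ℂ) hdvd)) hβ)
  -- `|g(0)| = ∏ |β| > 1`
  have hcoeff : gc.coeff 0 = (-1) ^ gc.natDegree * gc.roots.prod := hsplit.coeff_zero_eq_prod_roots_of_monic hgcm
  have hcard : 0 < Multiset.card gc.roots := by
    rw [← hsplit.natDegree_eq_card_roots, hgc, natDegree_map_eq_of_injective hinj]; exact hdeg
  have hnorm : 1 < ‖gc.roots.prod‖ := by
    obtain ⟨β, hβ⟩ := Multiset.card_pos_iff_exists_mem.1 hcard
    obtain ⟨s, hs⟩ := Multiset.exists_cons_of_mem hβ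
    rw [hs, Multiset.prod_cons, norm_mul]
    refine one_lt_mul_of_lt_of_le (hroots β hβ) (one_le_norm_multiset_prod fun x hx ↦ (hroots x ?_).le)
    rw [hs]; exact Multiset.mem_cons_of_mem hx
  -- whereas `g(0) = ±1`
  have hunit : ‖gc.coeff 0‖ = 1 := by
    rw [hgc, coeff_map, eq_intCast]
    rcases Int.isUnit_iff.1 h0 with h1 | h1 <;> rw [h1] <;> simp
  rw [hcoeff, norm_mul, norm_pow, norm_neg, norm_one, one_pow, one_mul] at hunit
  exact absurd hunit hnorm.ne'

include hT in
/-- **No unimodular factor ⟹ ergodic** (an exact endomorphism is ergodic: `IsExactEndomorphism.ergodic`); in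
particular no eigenvalue of such an `A` is a root of unity (`ToralEndomorphism.ergodic_iff_forall_mem_roots_charpoly_pow_ne_one`).
[cite: Walters1982, §4.9 Definition 4.14 and the remark after it (held text chunk p0126)]
[cite: AndersenThomsen2012, §4 Theorem 4.1 (held text arXiv:1204.0224 chunk p0010)] -/
theorem ergodic_of_forall_not_dvd_charpoly (hA : A.det ≠ 0)
    (h : ∀ g : ℤ[X], g.Monic → 0 < g.natDegree → IsUnit (g.coeff 0) → ¬ g ∣ A.charpoly) :
    _root_.Ergodic T volume :=
  ((isExactEndomorphism_iff_forall_not_dvd_charpoly A hT hA).2 h).ergodic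

end ToralEndomorphism

end Literature.Dynamics.Ergodic
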